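import Summits.BirchSwinnertonDyer.BirchSwinnertonDyer.Theorems.ManinLocalTwoThreeNaturalTes75OfOptimalTwin
import Summits.BirchSwinnertonDyer.BirchSwinnertonDyer.Theorems.ManinLocalTwoThreeStevensCurveDatum
import Summits.BirchSwinnertonDyer.BirchSwinnertonDyer.Theorems.ManinLocalTwoThreeShimuraKernelCyclicLattice
import Summits.BirchSwinnertonDyer.Rank1Residual.ManinAdditive.ShimuraKernelCyclic
import Literature.NumberTheory.EllipticCurves.ManinConstantDeuringTwistProofs
import HarnessLib

/-!
# EXO is UNCONDITIONAL: every modular parametrisation datum has a lattice-optimal twin on a globally minimal curve — no modularity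
(route `ManinLocalTwoThree`, crux C2 `ManinOddAtFour` stmt-BirchSwinnertonDyer-22967; cell bsd-f2-manin, prover seat p2 gen 24;
`--supports stmt-BirchSwinnertonDyer-22967`; = desc g30 TURNKEY T-desc-g30b (06:44Z) with the Literature theorem in place of the ABC-summit one)

The existence row EXO (es g40 `ExistsMinimalOptimalDatum`, landed by p3 as `ExistsMinimalOptimalDatum.existsMinimalOptimalDatum_of_modularity`
FROM `exists_isNewformOf`) needs NO modularity: the conductor hypothesis `W.conductorNorm ℤ = N` of Literature's
`exists_optimal_modularParametrizationData_of_edixhoven` is never used by its proof (it is introduced as `_`), and the datum-level engine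
`ModularParametrizationData.exists_optimalDatum_of_edixhoven` takes only Edixhoven 1991 Prop. 2 in lattice form — which is the Literature THEOREM
`edixhoven_int_of_neronLattice_eq_smul_periodLattice_holds` (`ManinConstantDeuringTwistProofs`, the Deuring-twist / Honda road).  Hence:

* §1 **`existsMinimalOptimalDatum`** — for EVERY elliptic `W/ℚ` and EVERY `X₀(N)`-datum `D` of `W`: a globally minimal elliptic `W₀ ~ W` with an
  `X₀(N)`-datum `D₀`, `D₀.f = D.f`, LATTICE-OPTIMAL (`Λ_{W₀} = c₀·Λ₀(f)`) and of minimal modular degree among all data with newform `D.f`.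
  UNCONDITIONAL (fact-free).  `existsMinimalOptimalDatum_forall` is the es row shape (p3's `…_of_modularity hnf` is the same with an idle `hnf`).
* §2 **`StevensCurve.optimalTwinOne`** — every `X₁(N)`-datum of every elliptic `W/ℚ` has an OPTIMAL `X₁(N)`-twin with Manin constant `1` and the
  same newform (p1's `optimalTwinOne_of_modularity` with `hnf` discharged); **`NaturalTes75.optimalTwin_of_CESweak`** — the optimal twin on a curve of
  one's choosing ⟸ CES-weak ALONE (p2 g23's `optimalTwin_of_modularity_CESweak` with `hnf` discharged).  UNCONDITIONAL resp. ⟸ CES-weak.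
* §3 **desc g26 rows 1 and 2 are EQUIVALENT, unconditionally**: `shimuraKernelCyclic_of_notInsideTwice : Gamma1PeriodsNotInsideTwiceGamma0Periods →
  ShimuraKernelCyclic` (the odd part of the cyclicity of `Λ₀(f)/Λ₁(f)` is p3's fact-free `KummerValues.not_periodLatticeGamma1_le_natCast_mul`, the
  assembly is p2's `ShimuraKernelLattice.cyclic_of_forall_prime_not_le_datum`) and `shimuraKernelCyclic_iff_notInsideTwice` (with desc's landed
  `notInsideTwice_of_shimuraKernelCyclic`).  So the Derickx–Orlić cyclicity question for the newform of an elliptic curve over `ℚ` is EXACTLY the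
  `2`-primary statement `Λ₁(f) ⊄ 2Λ₀(f)`; both rows remain ⟸ `exists_isNewformOf` (LEAD `StevensGalois.shimuraKernelCyclic_of_modularity`).

HONEST FRAMING: §1–§3 are unconditional kernel theorems about the tree's objects; nothing here proves C2, Manin's conjecture (`c₀ = 1`) or BSD, and
the items 22967/22968 stay OPEN as filed (their closers are conditional on CDT).  No definitions, no sorry.
[cite: EdixhovenManin1991, Prop. 2] [cite: AgasheRibetStein2006, Thm. 2.2] [cite: Knapp1993, Prop. 12.9(a)] [cite: Stevens1989, §2]
[cite: Vatsal2005, Rem. 1.4, Conj. 1.9]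
-/

set_option autoImplicit false
-- lint-debt: the directory name repeats the summit name (sibling precedent `ManinLocalTwoThreeExistsMinimalOptimalDatum.lean`)
set_option linter.dupNamespace false

noncomputable section

open scoped MatrixGroups ModularForm
open CongruenceSubgroup WeierstrassCurve Literature.NumberTheory.EllipticCurves Literature.NumberTheory.EllipticCurves.ModularForms
open Literature.NumberTheory.Automorphic

/-! ## §1 EXO without modularity -/

namespace Summit.BirchSwinnertonDyer.BirchSwinnertonDyer.Theorems.ManinLocalTwoThree.ExistsMinimalOptimalDatum

/-- **EXO, full form, UNCONDITIONAL.**  For every elliptic `W/ℚ` and every `X₀(N)`-datum `D` of `W` there are a globally minimal elliptic `W₀/ℚ`,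
`ℚ`-isogenous to `W`, and an `X₀(N)`-datum `D₀` of `W₀` with the same newform, whose Néron lattice is EXACTLY `D₀.c · Λ₀(f)` (lattice-optimal:
the strong Weil curve of the class in its minimal model) and whose modular degree is least among all data with that newform.  Proof:
`ModularParametrizationData.exists_optimalDatum_of_edixhoven` fed with the Literature THEOREM `edixhoven_int_of_neronLattice_eq_smul_periodLattice_holds`
(Edixhoven 1991 Prop. 2: the Manin constant of the strong Weil curve is an integer).  No `exists_isNewformOf`, no conductor.
[cite: EdixhovenManin1991, Prop. 2] [cite: AgasheRibetStein2006, Thm. 2.2] [cite: Knapp1993, Prop. 12.9(a)] -/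
theorem existsMinimalOptimalDatum_full (W : WeierstrassCurve ℚ) [W.IsElliptic] {N : ℕ} [NeZero N] (D : ModularParametrizationData W N) :
    ∃ (W₀ : WeierstrassCurve ℚ) (_ : W₀.IsElliptic) (_ : W₀.IsGloballyMinimal) (D₀ : ModularParametrizationData W₀ N),
      D₀.f = D.f ∧ W.IsIsogenous W₀ ∧ (∀ z ∈ D₀.L.lattice, ∃ w ∈ periodLattice D₀.f, z = D₀.c * w) ∧
        ∀ (W₂ : WeierstrassCurve ℚ) [W₂.IsElliptic] (D₂ : ModularParametrizationData W₂ N),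
          D₂.f = D₀.f → D₀.modularDegree ≤ D₂.modularDegree :=
  D.exists_optimalDatum_of_edixhoven
    (fun hf hL' q hq hq' ↦ edixhoven_int_of_neronLattice_eq_smul_periodLattice_holds hf hL' q hq hq')

/-- **EXO, UNCONDITIONAL** (the statement of p3's `existsMinimalOptimalDatum_of_modularity` with the modularity hypothesis REMOVED): every
`X₀(N)`-datum's newform is the newform of a LATTICE-OPTIMAL `X₀(N)`-datum on a GLOBALLY MINIMAL elliptic curve.
[cite: EdixhovenManin1991, Prop. 2] [cite: Knapp1993, Prop. 12.9(a)] -/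
theorem existsMinimalOptimalDatum (W : WeierstrassCurve ℚ) [W.IsElliptic] {N : ℕ} [NeZero N] (D : ModularParametrizationData W N) :
    ∃ (W₀ : WeierstrassCurve ℚ) (_ : W₀.IsElliptic) (_ : W₀.IsGloballyMinimal) (D₀ : ModularParametrizationData W₀ N),
      D₀.f = D.f ∧ ∀ z ∈ D₀.L.lattice, ∃ w ∈ periodLattice D₀.f, z = D₀.c * w := by
  obtain ⟨W₀, h₀, hmin, D₀, hf, -, hopt, -⟩ := existsMinimalOptimalDatum_full W D
  exact ⟨W₀, h₀, hmin, D₀, hf, hopt⟩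

/-- **EXO as the es `∀`-row `EsG40.ExistsMinimalOptimalDatum`, UNCONDITIONAL.** [cite: EdixhovenManin1991, Prop. 2] [cite: Knapp1993, Prop. 12.9(a)] -/
theorem existsMinimalOptimalDatum_forall :
    ∀ (W : WeierstrassCurve ℚ) [W.IsElliptic] {N : ℕ} [NeZero N] (D : ModularParametrizationData W N),
      ∃ (W₀ : WeierstrassCurve ℚ) (_ : W₀.IsElliptic) (_ : W₀.IsGloballyMinimal) (D₀ : ModularParametrizationData W₀ N),
        D₀.f = D.f ∧ ∀ z ∈ D₀.L.lattice, ∃ w ∈ periodLattice D₀.f, z = D₀.c * w :=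
  fun W _ _ _ D ↦ existsMinimalOptimalDatum W D

end Summit.BirchSwinnertonDyer.BirchSwinnertonDyer.Theorems.ManinLocalTwoThree.ExistsMinimalOptimalDatum

/-! ## §2 Optimal `X₁(N)`-twins without modularity -/

namespace Summit.BirchSwinnertonDyer.BirchSwinnertonDyer.Theorems.ManinLocalTwoThree.StevensCurve

/-- **Every `X₁(N)`-datum has an OPTIMAL twin with Manin constant `1` and the same newform — UNCONDITIONAL** (p1's `optimalTwinOne_of_modularity`
with `hnf` discharged by §1): `X₁(N)`-datum of `W` ⟹ `X₀(N)`-datum of `W` (`NaturalTes75.exists_modularParametrizationData_of_gamma1`) ⟹ lattice-optimal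
datum of a globally minimal curve (EXO, §1) ⟹ the Stevens curve `ℂ/Λ₁(f)` with its optimal datum, `c = 1` (`exists_optimal_gamma1ParametrizationData_one`).
[cite: Stevens1989, §2] [cite: EdixhovenManin1991, Prop. 2] -/
theorem optimalTwinOne {N : ℕ} [NeZero N] (W : WeierstrassCurve ℚ) [W.IsElliptic] (D : Gamma1ParametrizationData W N) :
    ∃ (E₁ : WeierstrassCurve ℚ) (_ : E₁.IsElliptic) (D₁ : Gamma1ParametrizationData E₁ N), D₁.IsOptimal ∧ D₁.c = 1 ∧ D₁.f = D.f := by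
  obtain ⟨D', hf', -, -⟩ := NaturalTes75.exists_modularParametrizationData_of_gamma1 D
  obtain ⟨W₀, _, _, D₀, hf₀, hopt⟩ := ExistsMinimalOptimalDatum.existsMinimalOptimalDatum W D'
  obtain ⟨E₁, hE₁, D₁, hf₁, hc₁, hD₁, -, -⟩ := exists_optimal_gamma1ParametrizationData_one D₀ hopt
  exact ⟨E₁, hE₁, D₁, hD₁, hc₁, by rw [hf₁, hf₀, hf']⟩

/-- **The optimal twin with Manin constant `1`, with its lattice and an isogeny to a minimal `X₀(N)`-optimal curve of the class** (same proof, all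
conjuncts kept): `Λ(D₁.L) = Λ₁(f)` and `E₁ ~ W₀` where `W₀` is globally minimal, lattice-optimal at level `N` and isogenous to `W`.  UNCONDITIONAL.
[cite: Stevens1989, §2] [cite: EdixhovenManin1991, Prop. 2] -/
theorem optimalTwinOne_full {N : ℕ} [NeZero N] (W : WeierstrassCurve ℚ) [W.IsElliptic] (D : Gamma1ParametrizationData W N) :
    ∃ (W₀ : WeierstrassCurve ℚ) (_ : W₀.IsElliptic) (_ : W₀.IsGloballyMinimal) (D₀ : ModularParametrizationData W₀ N)
      (E₁ : WeierstrassCurve ℚ) (_ : E₁.IsElliptic) (D₁ : Gamma1ParametrizationData E₁ N),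
      D₀.f = D.f ∧ W.IsIsogenous W₀ ∧ (∀ z ∈ D₀.L.lattice, ∃ w ∈ periodLattice D₀.f, z = D₀.c * w) ∧
        D₁.f = D.f ∧ D₁.c = 1 ∧ D₁.IsOptimal ∧ (∀ x, x ∈ D₁.L.lattice ↔ x ∈ periodLatticeGamma1 D.f) ∧ E₁.IsIsogenous W₀ := by
  obtain ⟨D', hf', -, -⟩ := NaturalTes75.exists_modularParametrizationData_of_gamma1 D
  obtain ⟨W₀, hW₀, hmin, D₀, hf₀, hiso, hopt, -⟩ := ExistsMinimalOptimalDatum.existsMinimalOptimalDatum_full W D'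
  haveI := hW₀
  obtain ⟨E₁, hE₁, D₁, hf₁, hc₁, hD₁, hL, hiso₁⟩ := exists_optimal_gamma1ParametrizationData_one D₀ hopt
  refine ⟨W₀, hW₀, hmin, D₀, E₁, hE₁, D₁, by rw [hf₀, hf'], hiso, hopt, by rw [hf₁, hf₀, hf'], hc₁, hD₁, fun x ↦ ?_, hiso₁⟩
  rw [hL x, hf₀, hf']

end Summit.BirchSwinnertonDyer.BirchSwinnertonDyer.Theorems.ManinLocalTwoThree.StevensCurve

namespace Summit.BirchSwinnertonDyer.BirchSwinnertonDyer.Theorems.ManinLocalTwoThree.NaturalTes75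

/-- **The optimal twin for every `X₁(N)`-datum ⟸ CES-weak ALONE** (p2 g23's `optimalTwin_of_modularity_CESweak` with `hnf` discharged by §1).
CONDITIONAL on CES-weak only. [cite: ConradEdixhovenStein2003, Thm. 1.1.3] [cite: EdixhovenManin1991, Prop. 2] -/
theorem optimalTwin_of_CESweak
    (hCESw : ∀ (W₀ : WeierstrassCurve ℚ) [W₀.IsElliptic] [W₀.IsGloballyMinimal] {N : ℕ} [NeZero N] (D₀ : ModularParametrizationData W₀ N),
      (∀ z ∈ D₀.L.lattice, ∃ w ∈ periodLattice D₀.f, z = D₀.c * w) →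
      ∃ (E₁ : WeierstrassCurve ℚ) (_ : E₁.IsElliptic) (D₁ : Gamma1ParametrizationData E₁ N), D₁.IsOptimal ∧ D₁.f = D₀.f)
    (W : WeierstrassCurve ℚ) [W.IsElliptic] {N : ℕ} [NeZero N] (D : Gamma1ParametrizationData W N) :
    ∃ (E₁ : WeierstrassCurve ℚ) (_ : E₁.IsElliptic) (D₁ : Gamma1ParametrizationData E₁ N), D₁.IsOptimal ∧ D₁.f = D.f := by
  obtain ⟨D', hf', -, -⟩ := exists_modularParametrizationData_of_gamma1 D
  obtain ⟨W₀, _, _, D₀, hf₀, hopt⟩ := ExistsMinimalOptimalDatum.existsMinimalOptimalDatum W D'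
  obtain ⟨E₁, hE₁, D₁, hD₁, hf₁⟩ := hCESw W₀ D₀ hopt
  exact ⟨E₁, hE₁, D₁, hD₁, by rw [hf₁, hf₀, hf']⟩

end Summit.BirchSwinnertonDyer.BirchSwinnertonDyer.Theorems.ManinLocalTwoThree.NaturalTes75

/-! ## §3 desc g26 rows 1 and 2 are equivalent, unconditionally -/

namespace Summit.BirchSwinnertonDyer.BirchSwinnertonDyer.Theorems.ManinLocalTwoThree.ExistsMinimalOptimalDatum

open Summit.BirchSwinnertonDyer.Rank1Residual.ManinAdditive

/-- **Per datum: `Λ₁(f) ⊄ 2Λ₀(f)` ALONE gives the cyclic Shimura kernel `Λ₀(f) = ℤz₀ + Λ₁(f)`** (the odd primes are p3's fact-free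
`KummerValues.not_periodLatticeGamma1_le_natCast_mul`; assembly p2's `ShimuraKernelLattice.cyclic_of_forall_prime_not_le_datum`).  UNCONDITIONAL.
[cite: Stevens1989, §2] [cite: Hungerford1974, Ch. IV Thm. 6.1] -/
theorem shimuraKernelCyclic_body_of_notHalfIndex (W : WeierstrassCurve ℚ) {N : ℕ} [NeZero N] (D : ModularParametrizationData W N)
    (h2 : ¬ (∀ z ∈ periodLatticeGamma1 D.f, ∃ w ∈ periodLattice D.f, z = 2 * w)) :
    ∃ z₀ ∈ periodLattice D.f, ∀ z ∈ periodLattice D.f, ∃ (k : ℤ) (w : ℂ), w ∈ periodLatticeGamma1 D.f ∧ z = (k : ℂ) * z₀ + w :=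
  ShimuraKernelLattice.shimuraKernelCyclic_body_of_parts D h2 fun ℓ hℓ hℓ2 ↦
    KummerValues.not_periodLatticeGamma1_le_natCast_mul D (by have := hℓ.two_le; omega)

/-- **Row 1 ⟹ row 2, UNCONDITIONAL**: `Gamma1PeriodsNotInsideTwiceGamma0Periods → ShimuraKernelCyclic`. [cite: Stevens1989, §2] -/
theorem shimuraKernelCyclic_of_notInsideTwice (h : ShimuraCyclic.Gamma1PeriodsNotInsideTwiceGamma0Periods) :
    ShimuraCyclic.ShimuraKernelCyclic :=
  fun W _ _ _ D ↦ shimuraKernelCyclic_body_of_notHalfIndex W D (h W D)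

/-- **desc g26 rows 1 and 2 are EQUIVALENT, unconditionally** (with desc's landed `ShimuraCyclic.notInsideTwice_of_shimuraKernelCyclic`): the
Derickx–Orlić cyclicity of `Λ₀(f)/Λ₁(f)` for the newform of a modular parametrisation datum is exactly its `2`-primary part `Λ₁(f) ⊄ 2Λ₀(f)`.
[cite: Stevens1989, §2] [cite: Vatsal2005, Conj. 1.9] -/
theorem shimuraKernelCyclic_iff_notInsideTwice :
    ShimuraCyclic.ShimuraKernelCyclic ↔ ShimuraCyclic.Gamma1PeriodsNotInsideTwiceGamma0Periods :=
  ⟨ShimuraCyclic.notInsideTwice_of_shimuraKernelCyclic, shimuraKernelCyclic_of_notInsideTwice⟩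

/-- **Row 2 per datum from row 1 ON LATTICE-OPTIMAL MINIMAL DATA only** (EXO moves the `2`-part hypothesis to the strong Weil curve): if
`Λ₁ ⊄ 2Λ₀` holds for every lattice-optimal `X₀(N)`-datum of every globally minimal elliptic curve, then `ShimuraKernelCyclic` holds for EVERY
datum.  UNCONDITIONAL glue (the hypothesis is what E-es-185/186 deliver under `exists_isNewformOf`). [cite: Stevens1989, §2] [cite: EdixhovenManin1991, Prop. 2] -/
theorem shimuraKernelCyclic_of_notHalfIndex_latticeOptimal
    (h : ∀ (W₀ : WeierstrassCurve ℚ) [W₀.IsElliptic] [W₀.IsGloballyMinimal] {N : ℕ} [NeZero N] (D₀ : ModularParametrizationData W₀ N),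
      (∀ z ∈ D₀.L.lattice, ∃ w ∈ periodLattice D₀.f, z = D₀.c * w) →
      ¬ (∀ z ∈ periodLatticeGamma1 D₀.f, ∃ w ∈ periodLattice D₀.f, z = 2 * w)) :
    ShimuraCyclic.ShimuraKernelCyclic := by
  intro W _ N _ D
  obtain ⟨W₀, hW₀, hmin, D₀, hf, hopt⟩ := existsMinimalOptimalDatum W D
  haveI := hW₀; haveI := hmin
  rw [← hf]
  exact shimuraKernelCyclic_body_of_notHalfIndex W₀ D₀ (h W₀ D₀ hopt)

end Summit.BirchSwinnertonDyer.BirchSwinnertonDyer.Theorems.ManinLocalTwoThree.ExistsMinimalOptimalDatum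

end
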